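import Literature.NumberTheory.Rogawski1990.ExplicitFactorProductFormula
import Literature.NumberTheory.Rogawski1990.AdelicStableConjugacy
import Literature.NumberTheory.Rogawski1990.AdelicKappaOrbitalEulerGp
import HarnessLib

/-!
# On a matching adèle the explicit adelic transfer factor is its total `κ`-sign:
# `Δ‴_𝐀(γ_H, γ̄_f) · Δ‴_∞(γ_H ⊗ 1, γ̄_∞) = (∏_v κ_v(γ_H, γ̄_v)) · ∏_w κ‴_w(γ_H ⊗ 1, γ̄_∞)`

Topic `NumberTheory/Rogawski1990`; namespace `Literature.NumberTheory.Rogawski1990`.  THEOREMS ONLY (no definition, no named fact, no instance, no notation,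
no `sorry`; net debt 0).  Cell `pub/hodgecm-mathlib`, F0∕P3a, topic T6 #72 side: the reduction of the (4.3.3) clause (node N5, `stub_kappaFormula` of the T6-L3
line) to a statement about `κ` alone.  For a rational `G`-regular `γ_H = (g, u)` and ANY matching adèle `γ̄ ∈ U(H′)(𝔸)` (★ `MatchingAdele`), the factors
`τ_v(γ_H)`, `D_{G∕H,v}(γ_H)` of `Δ‴_v(γ_H, γ̄_v) = τ_v · D_v · κ_v` read ONLY `γ_H` (★ `finExplicitDelta_of_isLocalNormPair`, ★ `archCanonicalDelta_of_isArchNormPair`),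
so their products over all places are `1` exactly as on a rational pair (★ `finprod_finTau_mul_archTau_eq_one`, ★ `finprod_finWeylRatio_mul_archWeylRatio_eq_one`
— Hecke characters on principal idèles and Artin–Whaples), and ★ `adelicFactor` collapses to the `κ`-signs.  Print: (4.3.3) `Δ_{G∕H}(γ_H, γ̄) = κ(obs(γ̄))`
[Rogawski1990 §4.3 p. 44] — after this file only the identification «total `κ`-sign = `κ(obs γ̄)`» (F0P3a-p04 (g8)'s N5 files) remains.

* **`adelicFactor_finExplicitCollection_eq_prod_kappa`** — under `IsGRegular γ_H` and finiteness of the `κ_v`-support along `γ̄` (★ p04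
  `MatchingAdele.eventually_finKappaAt_toLocal_eq_one` supplies it): `adelicFactor Δ‴ Δ‴_∞ γ_H γ̄ = (∏ᶠ_v κ_v) · ∏_w κ‴_w` in `ℂ`.

* ED. 2 (append-only): **`adelicFactor_finExplicitCollection_eq_one_of_isRationalOver`** — by ★ N4 (`satisfiesProductFormula_finExplicitCollection`) and the
  class invariance ★ `adelicFactor_eq_of_isConjAdele`, the explicit adelic factor is `1` on every matching adèle RATIONAL over some `γ` with `γ_H → γ`
  («`Δ_{G∕H}(γ_H, γ) = 1` since `obs(γ)` is trivial», read without `obs`), and hence so is its total `κ`-sign.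

HONEST LABEL: HC_CM is proved only modulo the printed citations (named inputs remaining 2) until rung 0 closes; nothing here proves any of them.

## References
* [Rogawski1990] J. D. Rogawski, *Automorphic Representations of Unitary Groups in Three Variables*, Ann. of Math. Stud. 123 (1990), §4.3 (4.3.3) p. 44; §4.9 p. 55;
  §14.6 p. 242.
* [LanglandsShelstad1987] R. P. Langlands, D. Shelstad, *On the definition of transfer factors*, Math. Ann. 278 (1987), §6.4.
-/

set_option autoImplicit false

noncomputable section

open NumberField NumberField.InfinitePlace IsDedekindDomain Filter
open Literature.NumberTheory.GaloisRepresentations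
open Literature.AlgebraicGeometry.ShimuraVarieties (hermForm)
open scoped Classical

namespace Literature.NumberTheory.Rogawski1990

open Literature.NumberTheory.Automorphic

variable (L : Type) [Field L] [NumberField L] [IsCMField L] (H' : Matrix (Fin 3) (Fin 3) L) (μ : HeckeCharacter L)
  {γH : (UnitaryGroup.cmDatum L 2 (Matrix.of fun i j : Fin 2 => if i.val + j.val + 1 = 2 then (1 : L) else 0)).Rational ×
      (UnitaryGroup.cmDatum L 1 (Matrix.of fun i j : Fin 1 => if i.val + j.val + 1 = 1 then (1 : L) else 0)).Rational}

/-- **ON A MATCHING ADÈLE THE EXPLICIT ADELIC FACTOR IS ITS TOTAL `κ`-SIGN**: for a rational `G`-regular `γ_H`, any matching adèle `γ̄` whose `κ_v(γ_H, γ̄_v)` are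
`1` for almost all `v`, and Rogawski's explicit collection (any invariance families `hl hr`),
`Δ‴_𝐀(γ_H, γ̄_f) · Δ‴_∞(γ_H ⊗ 1, γ̄_∞) = (∏ᶠ_v κ_v(γ_H, γ̄_v)) · ∏_{w complex} κ‴_w(γ_H ⊗ 1, γ̄_∞)` — the `τ`- and `D_{G∕H}`-products are `1`.
[cite: Rogawski1990, §4.3 (4.3.3) p. 44; §14.6 p. 242] [cite: LanglandsShelstad1987, §6.4] -/
theorem adelicFactor_finExplicitCollection_eq_prod_kappa
    (hl : ∀ (v : HeightOneSpectrum (𝓞 ↥(maximalRealSubfield L)))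
      (a : (UnitaryGroup.cmDatum L 2 (Matrix.of fun i j : Fin 2 => if i.val + j.val + 1 = 2 then (1 : L) else 0)).Local v ×
      (UnitaryGroup.cmDatum L 1 (Matrix.of fun i j : Fin 1 => if i.val + j.val + 1 = 1 then (1 : L) else 0)).Local v)
      (b : (UnitaryGroup.cmDatum L 3 H').Local v)
      (x : (UnitaryGroup.cmDatum L 2 (Matrix.of fun i j : Fin 2 => if i.val + j.val + 1 = 2 then (1 : L) else 0)).Local v ×
      (UnitaryGroup.cmDatum L 1 (Matrix.of fun i j : Fin 1 => if i.val + j.val + 1 = 1 then (1 : L) else 0)).Local v),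
      finExplicitDelta L v H' (x * a * x⁻¹) μ b = finExplicitDelta L v H' a μ b)
    (hr : ∀ (v : HeightOneSpectrum (𝓞 ↥(maximalRealSubfield L)))
      (a : (UnitaryGroup.cmDatum L 2 (Matrix.of fun i j : Fin 2 => if i.val + j.val + 1 = 2 then (1 : L) else 0)).Local v ×
      (UnitaryGroup.cmDatum L 1 (Matrix.of fun i j : Fin 1 => if i.val + j.val + 1 = 1 then (1 : L) else 0)).Local v)
      (b y : (UnitaryGroup.cmDatum L 3 H').Local v),
      finExplicitDelta L v H' a μ (y * b * y⁻¹) = finExplicitDelta L v H' a μ b)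
    (hreg : IsGRegular (cmConjRingHom L) (Matrix.of fun i j : Fin 2 => if i.val + j.val + 1 = 2 then (1 : L) else 0)
        (Matrix.of fun i j : Fin 1 => if i.val + j.val + 1 = 1 then (1 : L) else 0)
        (Matrix.of fun i j : Fin 3 => if i.val + j.val + 1 = 3 then (1 : L) else 0) endoForm_antidiagOne γH)
    (p : MatchingAdele L H' γH)
    (hκ : (Function.mulSupport fun v : HeightOneSpectrum (𝓞 ↥(maximalRealSubfield L)) =>
      finKappaAt L v H' (rationalComponent L γH v) ((UnitaryGroup.cmDatum L 3 H').toLocal v p.adele)).Finite) :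
    adelicFactor L H' (finExplicitCollection L H' μ hl hr) (fun a b => archCanonicalDelta L H' a μ b) γH p =
      (∏ᶠ v : HeightOneSpectrum (𝓞 ↥(maximalRealSubfield L)),
          ((finKappaAt L v H' (rationalComponent L γH v) ((UnitaryGroup.cmDatum L 3 H').toLocal v p.adele) : ℤ) : ℂ)) *
        ((∏ w : {w : InfinitePlace L // IsComplex w}, archKappaSignAt L H' (rationalArch L γH) w p.arch : ℤ) : ℂ) := by
  -- unfold to the explicit factors at the components and apply the `τ · D · κ` formulae
  change (∏ᶠ v : HeightOneSpectrum (𝓞 ↥(maximalRealSubfield L)),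
      finExplicitDelta L v H' (rationalComponent L γH v) μ ((UnitaryGroup.cmDatum L 3 H').toLocal v p.adele)) *
    archCanonicalDelta L H' (rationalArch L γH) μ p.arch = _
  rw [finprod_congr fun v => finExplicitDelta_of_isLocalNormPair L v H' (rationalComponent L γH v) μ (p.isLocalNormPair v),
    archCanonicalDelta_of_isArchNormPair L H' (rationalArch L γH) μ p.isArchNormPair]
  -- finiteness of the three supports
  have hτf : (Function.mulSupport fun v : HeightOneSpectrum (𝓞 ↥(maximalRealSubfield L)) => finTau L v (rationalComponent L γH v) μ).Finite :=
    eventually_cofinite.1 (eventually_finTau_rationalComponent_eq_one L γH μ hreg)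
  have hDf : (Function.mulSupport fun v : HeightOneSpectrum (𝓞 ↥(maximalRealSubfield L)) =>
      ((finWeylRatio L v (rationalComponent L γH v) : ℝ) : ℂ)).Finite := by
    refine (eventually_cofinite.1 (eventually_finWeylRatio_rationalComponent_eq_one L γH hreg)).subset fun v hv => ?_
    simp only [Function.mem_mulSupport, ne_eq] at hv
    by_contra hv'
    rw [Set.mem_setOf_eq, not_not] at hv'
    exact hv (by rw [hv', Complex.ofReal_one])
  have hκf : (Function.mulSupport fun v : HeightOneSpectrum (𝓞 ↥(maximalRealSubfield L)) =>
      ((finKappaAt L v H' (rationalComponent L γH v) ((UnitaryGroup.cmDatum L 3 H').toLocal v p.adele) : ℤ) : ℂ)).Finite := by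
    refine hκ.subset fun v hv => ?_
    simp only [Function.mem_mulSupport, ne_eq] at hv ⊢
    intro h1
    exact hv (by rw [h1, Int.cast_one])
  have hτ := finprod_finTau_mul_archTau_eq_one L μ γH hreg
  have hD := finprod_finWeylRatio_mul_archWeylRatio_eq_one L γH hreg
  have hDℂ : (∏ᶠ v : HeightOneSpectrum (𝓞 ↥(maximalRealSubfield L)), ((finWeylRatio L v (rationalComponent L γH v) : ℝ) : ℂ)) *
      (archWeylRatio L (rationalArch L γH) : ℂ) = 1 := by
    have hDf' : (Function.mulSupport fun v : HeightOneSpectrum (𝓞 ↥(maximalRealSubfield L)) =>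
        finWeylRatio L v (rationalComponent L γH v)).Finite :=
      hDf.subset fun v hv hv1 => hv (by
        change ((finWeylRatio L v (rationalComponent L γH v) : ℝ) : ℂ) = 1 at hv1
        change finWeylRatio L v (rationalComponent L γH v) = 1
        exact_mod_cast hv1)
    have hmap := map_finprod Complex.ofRealHom hDf'
    simp only [Complex.ofRealHom_eq_coe] at hmap
    rw [← hmap, ← Complex.ofReal_mul, hD, Complex.ofReal_one]
  rw [finprod_mul_distrib ((hτf.union hDf).subset (Function.mulSupport_mul _ _)) hκf, finprod_mul_distrib hτf hDf]
  calc (∏ᶠ v : HeightOneSpectrum (𝓞 ↥(maximalRealSubfield L)), finTau L v (rationalComponent L γH v) μ) *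
          (∏ᶠ v : HeightOneSpectrum (𝓞 ↥(maximalRealSubfield L)), ((finWeylRatio L v (rationalComponent L γH v) : ℝ) : ℂ)) *
          (∏ᶠ v : HeightOneSpectrum (𝓞 ↥(maximalRealSubfield L)),
            ((finKappaAt L v H' (rationalComponent L γH v) ((UnitaryGroup.cmDatum L 3 H').toLocal v p.adele) : ℤ) : ℂ)) *
        (archTau L (rationalArch L γH) μ * (archWeylRatio L (rationalArch L γH) : ℂ) *
          ((∏ w : {w : InfinitePlace L // IsComplex w}, archKappaSignAt L H' (rationalArch L γH) w p.arch : ℤ) : ℂ))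
      = ((∏ᶠ v : HeightOneSpectrum (𝓞 ↥(maximalRealSubfield L)), finTau L v (rationalComponent L γH v) μ) * archTau L (rationalArch L γH) μ) *
        ((∏ᶠ v : HeightOneSpectrum (𝓞 ↥(maximalRealSubfield L)), ((finWeylRatio L v (rationalComponent L γH v) : ℝ) : ℂ)) *
          (archWeylRatio L (rationalArch L γH) : ℂ)) *
        ((∏ᶠ v : HeightOneSpectrum (𝓞 ↥(maximalRealSubfield L)),
            ((finKappaAt L v H' (rationalComponent L γH v) ((UnitaryGroup.cmDatum L 3 H').toLocal v p.adele) : ℤ) : ℂ)) *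
          ((∏ w : {w : InfinitePlace L // IsComplex w}, archKappaSignAt L H' (rationalArch L γH) w p.arch : ℤ) : ℂ)) := by
        ring
    _ = _ := by rw [hτ, hDℂ, one_mul, one_mul]

/-! ## ED. 2 — the rational base point: `Δ‴_𝐀 · Δ‴_∞ = 1` on adèles rational over a global image -/

/-- **THE EXPLICIT ADELIC FACTOR IS `1` ON RATIONAL-OVER ADÈLES** (`c`-hermitian anisotropic `H′`): if `γ_H → γ` (★ `IsNormPair`) and the matching adèle `γ̄` is
`U(H′)(𝔸)`-conjugate to the diagonal image of `γ` (★ `MatchingAdele.IsRationalOver`), then `Δ‴_𝐀(γ_H, γ̄_f) · Δ‴_∞(γ_H ⊗ 1, γ̄_∞) = 1` — ★ N4 at `(γ_H, γ)` transported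
by ★ `adelicFactor_eq_of_isConjAdele`.  Print: «`Δ_{G∕H}(γ_H, γ) = 1` for the rational class» ((4.3.3) with `obs(γ)` trivial). [cite: Rogawski1990, §4.3 (4.3.3) p. 44; §5.4 p. 72] -/
theorem adelicFactor_finExplicitCollection_eq_one_of_isRationalOver (hherm : (H'.map (cmConjRingHom L)).transpose = H')
    (hanis : ∀ x : Fin 3 → L, hermForm (cmConjRingHom L) H' x x = 0 → x = 0)
    (hl : ∀ (v : HeightOneSpectrum (𝓞 ↥(maximalRealSubfield L)))
      (a : (UnitaryGroup.cmDatum L 2 (Matrix.of fun i j : Fin 2 => if i.val + j.val + 1 = 2 then (1 : L) else 0)).Local v ×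
      (UnitaryGroup.cmDatum L 1 (Matrix.of fun i j : Fin 1 => if i.val + j.val + 1 = 1 then (1 : L) else 0)).Local v)
      (b : (UnitaryGroup.cmDatum L 3 H').Local v)
      (x : (UnitaryGroup.cmDatum L 2 (Matrix.of fun i j : Fin 2 => if i.val + j.val + 1 = 2 then (1 : L) else 0)).Local v ×
      (UnitaryGroup.cmDatum L 1 (Matrix.of fun i j : Fin 1 => if i.val + j.val + 1 = 1 then (1 : L) else 0)).Local v),
      finExplicitDelta L v H' (x * a * x⁻¹) μ b = finExplicitDelta L v H' a μ b)
    (hr : ∀ (v : HeightOneSpectrum (𝓞 ↥(maximalRealSubfield L)))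
      (a : (UnitaryGroup.cmDatum L 2 (Matrix.of fun i j : Fin 2 => if i.val + j.val + 1 = 2 then (1 : L) else 0)).Local v ×
      (UnitaryGroup.cmDatum L 1 (Matrix.of fun i j : Fin 1 => if i.val + j.val + 1 = 1 then (1 : L) else 0)).Local v)
      (b y : (UnitaryGroup.cmDatum L 3 H').Local v),
      finExplicitDelta L v H' a μ (y * b * y⁻¹) = finExplicitDelta L v H' a μ b)
    (hreg : IsGRegular (cmConjRingHom L) (Matrix.of fun i j : Fin 2 => if i.val + j.val + 1 = 2 then (1 : L) else 0)
        (Matrix.of fun i j : Fin 1 => if i.val + j.val + 1 = 1 then (1 : L) else 0)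
        (Matrix.of fun i j : Fin 3 => if i.val + j.val + 1 = 3 then (1 : L) else 0) endoForm_antidiagOne γH)
    {γ : (UnitaryGroup.cmDatum L 3 H').Rational} (hγ : IsNormPair L H' γH γ) (p : MatchingAdele L H' γH) (hp : p.IsRationalOver γ) :
    adelicFactor L H' (finExplicitCollection L H' μ hl hr) (fun a b => archCanonicalDelta L H' a μ b) γH p = 1 := by
  -- the rational base point as a matching adèle
  let p₀ : MatchingAdele L H' γH := ⟨(UnitaryGroup.cmDatum L 3 H').toAdelic γ,
    fun v => isLocalNormPair_rationalComponent_toLocal_toAdelic hγ v,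
    by rw [archPart_cmDatum_toAdelic]; exact isArchNormPair_rationalArch_cmRationalToArch hγ⟩
  have hconj : p₀.IsConjAdele p := hp
  have h0 : adelicFactor L H' (finExplicitCollection L H' μ hl hr) (fun a b => archCanonicalDelta L H' a μ b) γH p₀ = 1 := by
    have h := satisfiesProductFormula_finExplicitCollection L H' μ hherm hanis hl hr γH γ hreg hγ
    change adelicTransferFactor L H' (finExplicitCollection L H' μ hl hr) _ ((UnitaryGroup.cmDatum L 3 H').toAdelic γ) *
      archCanonicalDelta L H' (rationalArch L γH) μ
        (UnitaryGroup.archPart (↥(maximalRealSubfield L)) L (IsCMField.complexConj L) 3 H' ((UnitaryGroup.cmDatum L 3 H').toAdelic γ)) = 1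
    rw [archPart_cmDatum_toAdelic]
    exact h
  rw [← h0]
  exact (adelicFactor_eq_of_isConjAdele (finExplicitCollection L H' μ hl hr) (archCanonicalTransferFactor L H' μ) hconj).symm

end Literature.NumberTheory.Rogawski1990
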